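import Literature.Geometry.Kaehler.ComplexTorusSimpleCMThreefoldEigenframe
import Literature.Geometry.Kaehler.ComplexTorusAbelianThreefoldImaginaryQuadraticTimesSurfaceConditionD
import Literature.Geometry.Kaehler.ComplexTorusHodgeGroupProductSl2Planes
import Literature.Geometry.Kaehler.ComplexTorusHodgeGroupProductLieAlgebraGoursat
import Literature.LinearAlgebra.CMThreefoldSurfaceCocharacterSplitting
import Literature.NumberTheory.Automorphic.TorusLieAlgebraIntegralSpan
import Literature.NumberTheory.Automorphic.LieAlgebraGLConjReindex
import Literature.NumberTheory.Automorphic.TorusRigidity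
import Literature.NumberTheory.Automorphic.ReductiveGLn
import HarnessLib

/-!
# Moonen–Zarhin (5.10), `d_min = 2`, both factors of CM type: `Hg(T × S) = Hg(T) × Hg(S)` for a simple CM abelian threefold `T`
# and a simple CM abelian surface `S`; hence CONDITION (D) FOR EVERY `T × S` WITH `T`, `S` SIMPLE (threefold × surface), and the
# isogeny ∕ «`Hg = Sp_D`» forms

Layer `Literature/Geometry/Kaehler`, namespace `Literature.Geometry.Kaehler.ComplexTorus`; lane `lit-hodgefound` (Track 2
foundations library), Layer A3∕A4; prover seat `lit-hodgefound-p17` (generation 55, self-proposed row g55-#12).  THEOREMS ONLY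
(no definition, no instance, no notation, no named fact; D-0026 net debt 0).

## Source, verbatim

B. Moonen, Yu. G. Zarhin, *Hodge classes on abelian varieties of low dimension*, Math. Ann. 315 (1999) 711–733
[MoonenZarhin1999LowDim], held `paper:arxiv-math_9901113`:
* §5 (5.10) (p0010 L18–L45): «First suppose that `d_min = 2`. Then `X ∼ Y₁ × Y₂` where `Y₁` is a simple abelian surface and `Y₂`
  is a simple abelian threefold. Note that `Y₁` is of CM-type with `Hg(Y₁) = U_{F₁}`, where `F₁ = End⁰(Y₁)`. […] If `Y₂` is of
  CM-type then `F₂ = End⁰(Y₂)` is a sextic CM-field. By Lemma (3.6) and Lemma (3.7), we can have `Hg(X) ≠ Hg(Y₁) × Hg(Y₂)` only if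
  `F₂` contains an imaginary quadratic field `k` such that `U_{F₁}` is isogenous to `SU_{F₂/k}`. […] Looking at Galois groups we
  obtain a contradiction. Hence again `Hg(X) = Hg(Y₁) × Hg(Y₂)`.»
* Thm. (0.2) (4) (p0002 L1–L8): «In particular, if `X` has no simple factor of dimension 4 then `Hg(X) = Sp_D(V,φ)` and
  `ℬ•(Xⁿ) = 𝒟•(Xⁿ)` for every `n ≥ 1`.»

## What is proved, and how (deviation from the print recorded)

* **`IsSimple.hodgeGroupC_prod_eq_blockDiagProd_of_hodgeGroup_comm_of_finrank_eq_three_two`** — (5.10) on complex points: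
  `Hg(T × S)(ℂ) = Hg(T)(ℂ) × Hg(S)(ℂ)` for a simple polarised threefold `T` and a simple polarised surface `S`, both with
  commutative Hodge groups (CM type).  PROOF (cocharacter form, as g53-#3 for Prop. (4.2)).  By g55-#11 `Hg(T)(ℂ) = P₁ 𝕋_{π₁} P₁⁻¹`
  (six eigenlines, `Aut(ℂ)` transitive on them), by g53-#2 `Hg(S)(ℂ) = P₂ 𝕋_{π₂} P₂⁻¹` (four eigenlines, a 4-cycle).  With
  `P = P₁ ⊕ P₂`, `L = {z | P diag(z) P⁻¹ ∈ Lie Hg(T × S)(ℂ)}` is contained in `A₁ × A₂`, projects onto both (Goursat position,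
  `exists_lieHom_toBlocks`), is spanned by integral vectors (cocharacters), and is carried into itself by the line permutations of
  every `σ ∈ Aut(ℂ)`.  The pure linear algebra of g55-#10 (`CMThreefoldSurface.forall_mem`: kernel dichotomy + PARITY — this is
  where the printed Galois-group comparison is replaced) gives `L = A₁ × A₂`, i.e. `(W 0; 0 0) ∈ Lie Hg(X)` for all `W ∈ Lie Hg(T)`,
  and the tree's `hodgeGroupC_prod_eq_blockDiagProd_of_forall_fromBlocks_zero_mem` splits `Hg(X)`.
* `IsSimple.finrank_centerField_eq_six_of_hodgeGroup_comm_of_finrank_eq_three` (a simple threefold with commutative Hodge group is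
  of type IV(3,1): `dim Hg < [End⁰ : ℚ]`).
* **`IsSimple.forall_divisorClasses_powPeriod_prod_eq_hodgeClasses_of_isSimple_of_finrank_eq_three_two`** — CONDITION (D) FOR `T × S`, `T` ANY
  SIMPLE POLARISED THREEFOLD, `S` ANY SIMPLE POLARISED SURFACE: not both CM by ✔ g55-#8, both CM by the splitting above and the
  (D)-transfer; the isogeny form and «`Hg(X) = Sp_D(V,φ)`» (real points) for every `X ∼ T × S`.
-/

noncomputable section

open Matrix Module Function

open scoped MatrixGroups

namespace Literature.Geometry.Kaehler

namespace ComplexTorus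

open Literature.NumberTheory.Automorphic (IsZConnected IsTorusSubgroup lieAlgebraGL lieSubalgebraGL diagonalSubgroup
  isMulCommutative_diagonalSubgroup isSemisimpleElt_of_mem_diagonalSubgroup mem_diagonalSubgroup_of_apply_eq_zero
  mem_lieAlgebraGL_map_conj_iff_inv_conj_mem mem_lieSubalgebraGL_iff)
open Literature.LinearAlgebra (CMSurfacePair.comp_mem_of_le_span_int CMThreefoldSurface.forall_mem)

/-! ### §0 Plumbing (file-local): block-diagonal frames (as in g53-#3) -/

section Plumbing

variable {ι₁ ι₂ : Type*} [Fintype ι₁] [DecidableEq ι₁] [Fintype ι₂] [DecidableEq ι₂]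

/-- `(P₁ ⊕ P₂)⁻¹ = P₁⁻¹ ⊕ P₂⁻¹`. [folklore] -/
private theorem fromBlocks_inv₅₆ {P₁ : Matrix ι₁ ι₁ ℂ} {P₂ : Matrix ι₂ ι₂ ℂ} (hP₁ : IsUnit P₁.det) (hP₂ : IsUnit P₂.det) :
    (fromBlocks P₁ 0 0 P₂)⁻¹ = fromBlocks P₁⁻¹ 0 0 P₂⁻¹ :=
  Matrix.inv_eq_right_inv (by
    rw [fromBlocks_multiply, Matrix.mul_nonsing_inv _ hP₁, Matrix.mul_nonsing_inv _ hP₂]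
    simp only [Matrix.mul_zero, Matrix.zero_mul, add_zero, zero_add, fromBlocks_one])

/-- Conjugating a diagonal matrix by a block-diagonal frame: `(P₁ ⊕ P₂) diag(z₁ ⊔ z₂) (P₁ ⊕ P₂)⁻¹ =
P₁ diag(z₁) P₁⁻¹ ⊕ P₂ diag(z₂) P₂⁻¹`. [folklore] -/
private theorem fromBlocks_conj_diagonal₅₆ {P₁ : Matrix ι₁ ι₁ ℂ} {P₂ : Matrix ι₂ ι₂ ℂ} (hP₁ : IsUnit P₁.det)
    (hP₂ : IsUnit P₂.det) (z₁ : ι₁ → ℂ) (z₂ : ι₂ → ℂ) :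
    fromBlocks P₁ 0 0 P₂ * diagonal (Sum.elim z₁ z₂) * (fromBlocks P₁ 0 0 P₂)⁻¹ =
      fromBlocks (P₁ * diagonal z₁ * P₁⁻¹) 0 0 (P₂ * diagonal z₂ * P₂⁻¹) := by
  rw [fromBlocks_inv₅₆ hP₁ hP₂, ← fromBlocks_diagonal, fromBlocks_multiply, fromBlocks_multiply]
  simp only [Matrix.mul_zero, Matrix.zero_mul, add_zero, zero_add]

/-- `det (P₁ ⊕ P₂)` is a unit. [folklore] -/
private theorem isUnit_det_fromBlocks₅₆ {P₁ : Matrix ι₁ ι₁ ℂ} {P₂ : Matrix ι₂ ι₂ ℂ} (hP₁ : IsUnit P₁.det)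
    (hP₂ : IsUnit P₂.det) : IsUnit (fromBlocks P₁ 0 0 P₂).det := by
  rw [det_fromBlocks_zero₂₁]
  exact hP₁.mul hP₂

variable {ι : Type*} [Fintype ι] [DecidableEq ι] {P : Matrix ι ι ℂ}

/-- `P (P⁻¹ X P) P⁻¹ = X`. [folklore] -/
private theorem mul_inv_conj_inv₅₆' (hP : IsUnit P.det) (X : Matrix ι ι ℂ) : P * (P⁻¹ * X * P) * P⁻¹ = X := by
  rw [show P * (P⁻¹ * X * P) * P⁻¹ = P * P⁻¹ * X * (P * P⁻¹) by simp only [Matrix.mul_assoc], Matrix.mul_nonsing_inv _ hP,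
    Matrix.one_mul, Matrix.mul_one]

/-- `P⁻¹ (P X P⁻¹) P = X`. [folklore] -/
private theorem inv_mul_conj_mul₅₆' (hP : IsUnit P.det) (X : Matrix ι ι ℂ) : P⁻¹ * (P * X * P⁻¹) * P = X := by
  rw [show P⁻¹ * (P * X * P⁻¹) * P = P⁻¹ * P * X * (P⁻¹ * P) by simp only [Matrix.mul_assoc], Matrix.nonsing_inv_mul _ hP,
    Matrix.one_mul, Matrix.mul_one]

/-- The frame coordinates are unique. [folklore] -/
private theorem conjDiag_injective₅₆' (hP : IsUnit P.det) {c c' : ι → ℂ}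
    (h : P * diagonal c * P⁻¹ = P * diagonal c' * P⁻¹) : c = c' := by
  have h' := congrArg (fun X ↦ P⁻¹ * X * P) h
  simp only [inv_mul_conj_mul₅₆' hP] at h'
  exact diagonal_injective h'

/-- Elements of `P 𝕋_π P⁻¹` are `P diag(d) P⁻¹`. [folklore] -/
private theorem exists_coe_eq_conj_diagonal₅₆ {π : ι → ι} (hπ : Involutive π) (hπ' : ∀ j, π j ≠ j) (hP : IsUnit P.det)
    {H : Subgroup (SpecialLinearGroup ι ℂ)} (hH : H = (pairedDiagTorus hπ hπ').map (conjGLC P hP).toMonoidHom)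
    {M : SpecialLinearGroup ι ℂ} (hM : M ∈ H) : ∃ d : ι → ℂ, (M : Matrix ι ι ℂ) = P * diagonal d * P⁻¹ := by
  rw [hH, Subgroup.mem_map_equiv, mem_pairedDiagTorus_iff, coe_conjGLC_symm] at hM
  obtain ⟨d, -, hM⟩ := hM
  exact ⟨d, by rw [← mul_inv_conj_inv₅₆' hP (M : Matrix ι ι ℂ), hM]⟩

end Plumbing

/-! ### §1 (5.10), both factors of CM type, from the frames -/

section Frames

variable {κ₁ κ₂ : Type} [Fintype κ₁] [DecidableEq κ₁] [Fintype κ₂] [DecidableEq κ₂]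
  {E₁ E₂ : Type} [NormedAddCommGroup E₁] [NormedSpace ℂ E₁] [FiniteDimensional ℂ E₁] [NormedAddCommGroup E₂]
  [NormedSpace ℂ E₂] [FiniteDimensional ℂ E₂] {Φ₁ : (κ₁ → ℝ) ≃L[ℝ] E₁} {Φ₂ : (κ₂ → ℝ) ≃L[ℝ] E₂}
  {η₁ : E₁ [⋀^Fin 2]→L[ℝ] ℝ} {η₂ : E₂ [⋀^Fin 2]→L[ℝ] ℝ}

omit [FiniteDimensional ℂ E₁] [FiniteDimensional ℂ E₂] in
/-- (5.10), `d_min = 2`, both CM, from the eigenframe data of the two factors (g55-#11 for `T`, g53-#2 for `S`): the frame-level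
core of the proof. [cite: MoonenZarhin1999LowDim, §5 (5.10) (p0010 L24–L45)] -/
private theorem hodgeGroupC_prod_eq_blockDiagProd_of_frames₅₆
    {π₁ : κ₁ → κ₁} (hπ₁ : Involutive π₁) (hπ₁' : ∀ j, π₁ j ≠ j) {P₁ : Matrix κ₁ κ₁ ℂ} (hP₁ : IsUnit P₁.det) {s₁ : κ₁ → ℂ}
    (hcard₁ : Fintype.card κ₁ = 6) (hHg₁ : hodgeGroupC Φ₁ = (pairedDiagTorus hπ₁ hπ₁').map (conjGLC P₁ hP₁).toMonoidHom)
    (hLie₁ : ∀ z : κ₁ → ℂ, P₁ * diagonal z * P₁⁻¹ ∈ lieAlgebraGL ((hodgeGroupC Φ₁).map Matrix.SpecialLinearGroup.toGL) ↔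
      ∀ j, z (π₁ j) = -z j)
    (hform₁ : ∀ Z ∈ lieAlgebraGL ((hodgeGroupC Φ₁).map Matrix.SpecialLinearGroup.toGL), ∃ z : κ₁ → ℂ,
      Z = P₁ * diagonal z * P₁⁻¹)
    (hs1₁ : ∀ j, s₁ j = 1 ∨ s₁ j = -1) (hsπ₁ : ∀ j, s₁ (π₁ j) = -s₁ j)
    (hperm₁ : ∀ σ : ℂ ≃+* ℂ, ∃ g : Equiv.Perm κ₁, (∀ j, g (π₁ j) = π₁ (g j)) ∧
      ∀ z : κ₁ → ℂ, (P₁ * diagonal z * P₁⁻¹).map σ = P₁ * diagonal (fun j ↦ σ (z (g j))) * P₁⁻¹)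
    (htrans₁ : ∀ j j' : κ₁, ∃ (σ : ℂ ≃+* ℂ) (g : Equiv.Perm κ₁),
      (∀ z : κ₁ → ℂ, (P₁ * diagonal z * P₁⁻¹).map σ = P₁ * diagonal (fun k ↦ σ (z (g k))) * P₁⁻¹) ∧
      (∀ k, g (π₁ k) = π₁ (g k)) ∧ g j = j')
    {π₂ : κ₂ → κ₂} (hπ₂ : Involutive π₂) (hπ₂' : ∀ m, π₂ m ≠ m) {P₂ : Matrix κ₂ κ₂ ℂ} (hP₂ : IsUnit P₂.det) {s₂ : κ₂ → ℂ}
    (hcard₂ : Fintype.card κ₂ = 4) (hHg₂ : hodgeGroupC Φ₂ = (pairedDiagTorus hπ₂ hπ₂').map (conjGLC P₂ hP₂).toMonoidHom)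
    (hLie₂ : ∀ z : κ₂ → ℂ, P₂ * diagonal z * P₂⁻¹ ∈ lieAlgebraGL ((hodgeGroupC Φ₂).map Matrix.SpecialLinearGroup.toGL) ↔
      ∀ m, z (π₂ m) = -z m)
    (hform₂ : ∀ Z ∈ lieAlgebraGL ((hodgeGroupC Φ₂).map Matrix.SpecialLinearGroup.toGL), ∃ z : κ₂ → ℂ,
      Z = P₂ * diagonal z * P₂⁻¹)
    (hsπ₂ : ∀ m, s₂ (π₂ m) = -s₂ m)
    (hperm₂ : ∀ σ : ℂ ≃+* ℂ, ∃ g : Equiv.Perm κ₂, (∀ m, g (π₂ m) = π₂ (g m)) ∧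
      ∀ z : κ₂ → ℂ, (P₂ * diagonal z * P₂⁻¹).map σ = P₂ * diagonal (fun m ↦ σ (z (g m))) * P₂⁻¹)
    {σ₂ : ℂ ≃+* ℂ} {g₂ : Equiv.Perm κ₂} {m₀ m₀' : κ₂}
    (hσ₂ : ∀ z : κ₂ → ℂ, (P₂ * diagonal z * P₂⁻¹).map σ₂ = P₂ * diagonal (fun m ↦ σ₂ (z (g₂ m))) * P₂⁻¹)
    (hg₂π : ∀ m, g₂ (π₂ m) = π₂ (g₂ m)) (hm : m₀ ≠ m₀') (hsm₀ : s₂ m₀ = 1) (hsm₀' : s₂ m₀' = 1) (hgm₀ : g₂ m₀ = m₀')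
    (hgm₀' : g₂ m₀' = π₂ m₀) :
    hodgeGroupC (prodPeriod Φ₁ Φ₂) = blockDiagProd (hodgeGroupC Φ₁) (hodgeGroupC Φ₂) := by
  classical
  -- the groups and the big frame `P = P₁ ⊕ P₂`
  set G := (hodgeGroupC (prodPeriod Φ₁ Φ₂)).map Matrix.SpecialLinearGroup.toGL with hG_def
  set G₁ := (hodgeGroupC Φ₁).map Matrix.SpecialLinearGroup.toGL with hG₁_def
  set G₂ := (hodgeGroupC Φ₂).map Matrix.SpecialLinearGroup.toGL with hG₂_def
  obtain ⟨P, hP_def⟩ : ∃ P : Matrix (κ₁ ⊕ κ₂) (κ₁ ⊕ κ₂) ℂ, P = fromBlocks P₁ 0 0 P₂ := ⟨_, rfl⟩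
  have hP : IsUnit P.det := hP_def ▸ isUnit_det_fromBlocks₅₆ hP₁ hP₂
  have hconj : ∀ (z₁ : κ₁ → ℂ) (z₂ : κ₂ → ℂ), P * diagonal (Sum.elim z₁ z₂) * P⁻¹ =
      fromBlocks (P₁ * diagonal z₁ * P₁⁻¹) 0 0 (P₂ * diagonal z₂ * P₂⁻¹) := fun z₁ z₂ ↦ by
    rw [hP_def, fromBlocks_conj_diagonal₅₆ hP₁ hP₂]
  have hconj' : ∀ z : κ₁ ⊕ κ₂ → ℂ, P * diagonal z * P⁻¹ =
      fromBlocks (P₁ * diagonal (fun j ↦ z (.inl j)) * P₁⁻¹) 0 0 (P₂ * diagonal (fun m ↦ z (.inr m)) * P₂⁻¹) := fun z ↦ by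
    have h := hconj (z ∘ Sum.inl) (z ∘ Sum.inr)
    rw [Sum.elim_comp_inl_inr] at h
    exact h
  -- `L = {z | P diag(z) P⁻¹ ∈ Lie Hg(Y₁ × Y₂)(ℂ)}`
  obtain ⟨L, hL⟩ : ∃ L : Submodule ℂ (κ₁ ⊕ κ₂ → ℂ), ∀ z, z ∈ L ↔ P * diagonal z * P⁻¹ ∈ lieAlgebraGL G :=
    ⟨(lieAlgebraGL G).comap
      { toFun := fun z ↦ P * diagonal z * P⁻¹
        map_add' := fun a b ↦ by
          rw [show diagonal (a + b) = diagonal a + diagonal b from (diagonal_add a b).symm, Matrix.mul_add, Matrix.add_mul]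
        map_smul' := fun c a ↦ by
          rw [RingHom.id_apply, show diagonal (c • a) = c • diagonal a from diagonal_smul c a, Matrix.mul_smul,
            Matrix.smul_mul] },
      fun _ ↦ Iff.rfl⟩
  -- (i) `L ⊆ A₁ × A₂`: the blocks of `P diag(z) P⁻¹ ∈ Lie Hg(X)` lie in `Lie Hg(Y₁)`, `Lie Hg(Y₂)`
  have hLblocks : ∀ z ∈ L, P₁ * diagonal (fun j ↦ z (.inl j)) * P₁⁻¹ ∈ lieAlgebraGL G₁ ∧
      P₂ * diagonal (fun m ↦ z (.inr m)) * P₂⁻¹ ∈ lieAlgebraGL G₂ := fun z hz ↦ by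
    have hZ := (hL z).1 hz
    rw [hconj'] at hZ
    obtain ⟨-, h₁, h₂⟩ := eq_fromBlocks_of_mem_lieAlgebraGL_hodgeGroupC_prod Φ₁ Φ₂ hZ
    rw [toBlocks_fromBlocks₁₁] at h₁
    rw [toBlocks_fromBlocks₂₂] at h₂
    exact ⟨h₁, h₂⟩
  have hL₁ : ∀ z ∈ L, ∀ j, z (.inl (π₁ j)) = -z (.inl j) := fun z hz ↦ (hLie₁ _).1 (hLblocks z hz).1
  have hL₂ : ∀ z ∈ L, ∀ m, z (.inr (π₂ m)) = -z (.inr m) := fun z hz ↦ (hLie₂ _).1 (hLblocks z hz).2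
  -- every element of `Lie Hg(X)(ℂ)` is a `P diag(z₁ ⊔ z₂) P⁻¹`
  have hZform : ∀ Z ∈ lieAlgebraGL G, ∃ (z₁ : κ₁ → ℂ) (z₂ : κ₂ → ℂ), Z = P * diagonal (Sum.elim z₁ z₂) * P⁻¹ ∧
      Z.toBlocks₁₁ = P₁ * diagonal z₁ * P₁⁻¹ ∧ Z.toBlocks₂₂ = P₂ * diagonal z₂ * P₂⁻¹ := fun Z hZ ↦ by
    obtain ⟨hZeq, hZ₁, hZ₂⟩ := eq_fromBlocks_of_mem_lieAlgebraGL_hodgeGroupC_prod Φ₁ Φ₂ hZ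
    obtain ⟨z₁, hz₁⟩ := hform₁ _ hZ₁
    obtain ⟨z₂, hz₂⟩ := hform₂ _ hZ₂
    refine ⟨z₁, z₂, ?_, hz₁, hz₂⟩
    rw [hconj, ← hz₁, ← hz₂]
    exact hZeq
  -- (i') `L → A₁` is onto («`Hg(X)` projects surjectively to both factors», the Goursat position of `Lie Hg(X)`)
  obtain ⟨f, g, hf, hg, hfs, hgs, -⟩ := exists_lieHom_toBlocks Φ₁ Φ₂
  have hsurj₁ : ∀ w : κ₁ → ℂ, (∀ j, w (π₁ j) = -w j) → ∃ z ∈ L, ∀ j, z (.inl j) = w j := fun w hw ↦ by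
    have hW : P₁ * diagonal w * P₁⁻¹ ∈ lieSubalgebraGL G₁ := (mem_lieSubalgebraGL_iff).2 ((hLie₁ w).2 hw)
    obtain ⟨Z, hZ⟩ := hfs ⟨_, hW⟩
    obtain ⟨z₁, z₂, hZeq, hZ₁, -⟩ := hZform Z ((mem_lieSubalgebraGL_iff).1 Z.2)
    have h1 : P₁ * diagonal z₁ * P₁⁻¹ = P₁ * diagonal w * P₁⁻¹ := by
      rw [← hZ₁, ← hf Z, hZ]
    have hz₁w : z₁ = w := conjDiag_injective₅₆' hP₁ h1
    refine ⟨Sum.elim z₁ z₂, (hL _).2 ?_, fun j ↦ by rw [Sum.elim_inl, hz₁w]⟩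
    rw [← hZeq]
    exact (mem_lieSubalgebraGL_iff).1 Z.2
  have hsurj₂ : ∀ w : κ₂ → ℂ, (∀ m, w (π₂ m) = -w m) → ∃ z ∈ L, ∀ m, z (.inr m) = w m := fun w hw ↦ by
    have hW : P₂ * diagonal w * P₂⁻¹ ∈ lieSubalgebraGL G₂ := (mem_lieSubalgebraGL_iff).2 ((hLie₂ w).2 hw)
    obtain ⟨Z, hZ⟩ := hgs ⟨_, hW⟩
    obtain ⟨z₁, z₂, hZeq, -, hZ₂⟩ := hZform Z ((mem_lieSubalgebraGL_iff).1 Z.2)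
    have h1 : P₂ * diagonal z₂ * P₂⁻¹ = P₂ * diagonal w * P₂⁻¹ := by
      rw [← hZ₂, ← hg Z, hZ]
    have hz₂w : z₂ = w := conjDiag_injective₅₆' hP₂ h1
    refine ⟨Sum.elim z₁ z₂, (hL _).2 ?_, fun m ↦ by rw [Sum.elim_inr, hz₂w]⟩
    rw [← hZeq]
    exact (mem_lieSubalgebraGL_iff).1 Z.2
  -- (ii) `L` is spanned by its integral vectors: `Hg(X)(ℂ)` is a torus which `P` conjugates into the diagonal
  obtain ⟨P', hP'P⟩ : ∃ P' : GL (κ₁ ⊕ κ₂) ℂ, (P' : Matrix (κ₁ ⊕ κ₂) (κ₁ ⊕ κ₂) ℂ) = P := ⟨Matrix.nonsingInvUnit P hP, rfl⟩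
  have hP'inv : ((P'⁻¹ : GL (κ₁ ⊕ κ₂) ℂ) : Matrix (κ₁ ⊕ κ₂) (κ₁ ⊕ κ₂) ℂ) = P⁻¹ := by
    rw [Matrix.coe_units_inv, hP'P]
  set T' := G.map (MulAut.conj P'⁻¹ : GL (κ₁ ⊕ κ₂) ℂ →* GL (κ₁ ⊕ κ₂) ℂ) with hT'_def
  have hT'le : T' ≤ diagonalSubgroup (κ₁ ⊕ κ₂) ℂ := by
    rintro _ ⟨x, hx, rfl⟩
    obtain ⟨M, hM, rfl⟩ := Subgroup.mem_map.1 hx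
    obtain ⟨A, hA, B, hB, rfl⟩ := exists_eq_blockDiagC_of_mem_hodgeGroupC_prod Φ₁ Φ₂ hM
    obtain ⟨d₁, hd₁⟩ := exists_coe_eq_conj_diagonal₅₆ hπ₁ hπ₁' hP₁ hHg₁ hA
    obtain ⟨d₂, hd₂⟩ := exists_coe_eq_conj_diagonal₅₆ hπ₂ hπ₂' hP₂ hHg₂ hB
    apply mem_diagonalSubgroup_of_apply_eq_zero
    intro i k hik
    rw [MonoidHom.coe_coe, MulAut.conj_apply, inv_inv, Units.val_mul, Units.val_mul, hP'P, hP'inv,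
      Matrix.SpecialLinearGroup.coe_GL_coe_matrix, coe_blockDiagC, hd₁, hd₂, ← hconj, inv_mul_conj_mul₅₆' hP,
      diagonal_apply_ne _ hik]
  have hcommT' : IsMulCommutative ↥T' := ⟨⟨fun a b ↦ Subtype.ext (by
    have h : (a : GL (κ₁ ⊕ κ₂) ℂ) * b = b * a := congrArg Subtype.val
      ((isMulCommutative_diagonalSubgroup (n := κ₁ ⊕ κ₂) (k := ℂ)).is_comm.comm ⟨a.1, hT'le a.2⟩ ⟨b.1, hT'le b.2⟩)
    exact h)⟩⟩
  have hT' : IsTorusSubgroup T' := ⟨(isZConnected_map_toGL_hodgeGroupC (prodPeriod Φ₁ Φ₂)).map_conj P'⁻¹, hcommT',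
    fun t ht ↦ isSemisimpleElt_of_mem_diagonalSubgroup (hT'le ht)⟩
  have hLT : ∀ z : κ₁ ⊕ κ₂ → ℂ, z ∈ L ↔ diagonal z ∈ lieAlgebraGL T' := fun z ↦ by
    rw [hL, hT'_def, mem_lieAlgebraGL_map_conj_iff_inv_conj_mem, inv_inv, hP'P, hP'inv]
  obtain ⟨r, m, hmLie, hmspan⟩ := hT'.exists_integral_diagonal_span_of_le_diagonal hT'le
  have hint : L ≤ Submodule.span ℂ {z | z ∈ L ∧ ∀ x, ∃ n : ℤ, z x = n} := fun z hz ↦ by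
    obtain ⟨c, hc⟩ := hmspan (diagonal z) ((hLT z).1 hz)
    have hz' : z = ∑ i, c i • (fun a ↦ ((m i a : ℤ) : ℂ)) := by
      ext a
      have h := congrFun (congrFun hc a) a
      rw [diagonal_apply_eq, Matrix.sum_apply] at h
      rw [h, Finset.sum_apply]
      refine Finset.sum_congr rfl fun i _ ↦ ?_
      rw [Matrix.smul_apply, diagonal_apply_eq, Pi.smul_apply]
    rw [hz']
    exact Submodule.sum_mem _ fun i _ ↦ Submodule.smul_mem _ _
      (Submodule.subset_span ⟨(hLT _).2 (hmLie i), fun x ↦ ⟨m i x, rfl⟩⟩)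
  -- (iii) `Aut(ℂ)`-stability of `Lie Hg(X)(ℂ)` read on `L`: `z ∘ (g_σ ⊔ g'_σ) ∈ L` for integral `z ∈ L`
  have hstab : ∀ (σ : ℂ ≃+* ℂ) (a₁ : Equiv.Perm κ₁) (a₂ : Equiv.Perm κ₂),
      (∀ z : κ₁ → ℂ, (P₁ * diagonal z * P₁⁻¹).map σ = P₁ * diagonal (fun j ↦ σ (z (a₁ j))) * P₁⁻¹) →
      (∀ z : κ₂ → ℂ, (P₂ * diagonal z * P₂⁻¹).map σ = P₂ * diagonal (fun j ↦ σ (z (a₂ j))) * P₂⁻¹) →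
      ∀ z ∈ L, (∀ x, ∃ n : ℤ, z x = n) → z ∘ Sum.map a₁ a₂ ∈ L := fun σ a₁ a₂ ha₁ ha₂ z hz hzi ↦ by
    have hσz : ∀ x, σ (z x) = z x := fun x ↦ by
      obtain ⟨n, hn⟩ := hzi x
      rw [hn, map_intCast]
    have hZ := map_mem_lieAlgebraGL_of_forall_map_mem (isAutStableGL_map_toGL_hodgeGroupC (prodPeriod Φ₁ Φ₂)).map_mem σ
      ((hL z).1 hz)
    rw [hconj', fromBlocks_map, ha₁, ha₂, Matrix.map_zero _ (map_zero _), Matrix.map_zero _ (map_zero _)] at hZ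
    simp only [hσz] at hZ
    refine (hL _).2 ?_
    rw [hconj']
    exact hZ
  -- the cocharacter splitting of g55-#10: `L = A₁ × A₂`
  obtain ⟨b₁, -, hb₁⟩ := hperm₁ σ₂
  have hs0₁ : ∀ j, s₁ j ≠ 0 := fun j h0 ↦ by
    rcases hs1₁ j with h | h <;> rw [h0] at h <;> norm_num at h
  have hstab' : ∀ z ∈ L, z ∘ Sum.map b₁ g₂ ∈ L := fun z hz ↦
    CMSurfacePair.comp_mem_of_le_span_int hint (Sum.map b₁ g₂) (hstab σ₂ b₁ g₂ hb₁ hσ₂) hz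
  have htrans : ∀ j j' : κ₁, ∃ (e : Equiv.Perm κ₁) (e₂ : κ₂ → κ₂), (∀ z ∈ L, z ∘ Sum.map e e₂ ∈ L) ∧
      (∀ k, e (π₁ k) = π₁ (e k)) ∧ e j = j' := fun j j' ↦ by
    obtain ⟨σ, e, he, heπ, hej⟩ := htrans₁ j j'
    obtain ⟨e₂, -, he₂⟩ := hperm₂ σ
    exact ⟨e, e₂, fun z hz ↦ CMSurfacePair.comp_mem_of_le_span_int hint (Sum.map e e₂) (hstab σ e e₂ he he₂) hz, heπ, hej⟩
  have hall := CMThreefoldSurface.forall_mem (L := L) hcard₁ hcard₂ hπ₁ hπ₁' hπ₂ hs0₁ hsπ₁ hsπ₂ hm hsm₀ hsm₀' hL₁ hL₂ hsurj₁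
    hsurj₂ hint b₁ hstab' hg₂π hgm₀ hgm₀' htrans
  -- `(W 0; 0 0) ∈ Lie Hg(X)` for every `W ∈ Lie Hg(T)`, so `Hg(X)` splits
  refine hodgeGroupC_prod_eq_blockDiagProd_of_forall_fromBlocks_zero_mem Φ₁ Φ₂ fun W hW ↦ ?_
  obtain ⟨w, rfl⟩ := hform₁ W hW
  have hw : ∀ j, w (π₁ j) = -w j := (hLie₁ w).1 hW
  have hz : Sum.elim w (0 : κ₂ → ℂ) ∈ L :=
    hall _ (fun j ↦ by rw [Sum.elim_inl, Sum.elim_inl, hw]) (fun m' ↦ by simp only [Sum.elim_inr, Pi.zero_apply, neg_zero])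
  have hZ := (hL _).1 hz
  rwa [hconj, diagonal_zero', Matrix.mul_zero, Matrix.zero_mul] at hZ

/-- **A SIMPLE THREEFOLD WITH COMMUTATIVE HODGE GROUP IS OF TYPE IV(3,1): `[Z(End⁰ T) : ℚ] = 6`** (`𝒜` abelian is its own centre,
and `dim 𝔷(𝒜) < [End⁰(T) : ℚ]`; the cases `e = 1, 3, 2` have `dim Hg = 21, 9, 9`). [cite: MoonenZarhin1999LowDim, §2 (2.3) `g = 3` and Prop. (2.4) (p0005 L83–L118)] -/
theorem IsSimple.finrank_centerField_eq_six_of_hodgeGroup_comm_of_finrank_eq_three [Nonempty κ₁] (hT : IsSimple Φ₁)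
    (hη : IsRiemannForm Φ₁ η₁) (h3 : finrank ℂ E₁ = 3) (hc : ∀ M ∈ hodgeGroup Φ₁, ∀ N ∈ hodgeGroup Φ₁, M * N = N * M) :
    finrank ℚ (centerField Φ₁ hT) = 6 := by
  haveI : IsLieAbelian (hodgeGroupLieRat Φ₁) := (isLieAbelian_hodgeGroupLieRat_iff_hodgeGroup_comm Φ₁).2 hc
  have hz := finrank_center_hodgeGroupLieRat_lt_finrank_endAlgRat Φ₁
  have hcen : LieAlgebra.center ℚ (hodgeGroupLieRat Φ₁) = ⊤ := (LieAlgebra.isLieAbelian_iff_center_eq_top ℚ _).1 ‹_›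
  have hzdim : finrank ℚ (LieAlgebra.center ℚ (hodgeGroupLieRat Φ₁)) = finrank ℝ (hodgeGroupLie Φ₁) := by
    rw [← finrank_hodgeGroupLieRat_eq Φ₁, show finrank ℚ (LieAlgebra.center ℚ (hodgeGroupLieRat Φ₁)) =
      finrank ℚ (LieSubmodule.toSubmodule (LieAlgebra.center ℚ (hodgeGroupLieRat Φ₁))) from rfl, hcen,
      LieSubmodule.top_toSubmodule, finrank_top]
  have hE : finrank ℚ (endAlgRat Φ₁) = finrank ℚ (centerField Φ₁ hT) :=
    (finrank_centerField_eq_of_comm hT fun a b ↦ Subtype.ext (hT.endAlgRat_comm_of_finrank_eq_three h3 a.1 a.2 b.1 b.2)).symm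
  rw [hzdim, hE] at hz
  rcases (hT.four_cases_of_finrank_eq_three hη h3).2 with ⟨-, h1, -, -, h21⟩ | ⟨-, h3', h9⟩ | ⟨-, h2', h9⟩ | ⟨-, h6, -, -⟩
  · omega
  · omega
  · omega
  · exact h6

/-- **MOONEN–ZARHIN (5.10), `d_min = 2`, BOTH FACTORS OF CM TYPE: `Hg(T × S)(ℂ) = Hg(T)(ℂ) × Hg(S)(ℂ)`** for a simple polarised
abelian threefold `T` and a simple polarised abelian surface `S` with COMMUTATIVE Hodge groups («Hence again
`Hg(X) = Hg(Y₁) × Hg(Y₂)`»; here by the cocharacter splitting of g55-#10 — parity in place of the Galois-group comparison).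
[cite: MoonenZarhin1999LowDim, §5 (5.10) (p0010 L18–L45), §3 Lemma (3.6)–(3.7), §4 (4.1)] [cite: Springer1998, 4.4.13 and 3.2.10 (4)]
[cite: Borel1991, §8.11] -/
theorem IsSimple.hodgeGroupC_prod_eq_blockDiagProd_of_hodgeGroup_comm_of_finrank_eq_three_two [Nonempty κ₁] (hT : IsSimple Φ₁)
    (hS : IsSimple Φ₂) (hη₁ : IsRiemannForm Φ₁ η₁) (hη₂ : IsRiemannForm Φ₂ η₂) (h3 : finrank ℂ E₁ = 3) (h2 : finrank ℂ E₂ = 2)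
    (hc₁ : ∀ M ∈ hodgeGroup Φ₁, ∀ N ∈ hodgeGroup Φ₁, M * N = N * M)
    (hc₂ : ∀ M ∈ hodgeGroup Φ₂, ∀ N ∈ hodgeGroup Φ₂, M * N = N * M) :
    hodgeGroupC (prodPeriod Φ₁ Φ₂) = blockDiagProd (hodgeGroupC Φ₁) (hodgeGroupC Φ₂) := by
  have he := hT.finrank_centerField_eq_six_of_hodgeGroup_comm_of_finrank_eq_three hη₁ h3 hc₁
  obtain ⟨π₁, hπ₁, hπ₁', P₁, hP₁, s₁, hcard₁, hHg₁, hLie₁, hform₁, hs1₁, hsπ₁, -, hperm₁, htrans₁⟩ :=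
    hT.exists_cmEigenframe_of_finrank_centerField_eq_six_of_finrank_eq_three hη₁ h3 he
  obtain ⟨π₂, hπ₂, hπ₂', P₂, hP₂, s₂, hcard₂, hHg₂, hLie₂, hform₂, -, hsπ₂, -, hperm₂, σ₂, g₂, m₀, m₀', hσ₂, hg₂π, hm, hsm₀,
    hsm₀', hgm₀, hgm₀'⟩ := hS.exists_cmEigenframe_of_hodgeGroup_comm_of_finrank_eq_two hη₂ h2 hc₂
  exact hodgeGroupC_prod_eq_blockDiagProd_of_frames₅₆ hπ₁ hπ₁' hP₁ hcard₁ hHg₁ hLie₁ hform₁ hs1₁ hsπ₁ hperm₁ htrans₁ hπ₂ hπ₂' hP₂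
    hcard₂ hHg₂ hLie₂ hform₂ hsπ₂ hperm₂ hσ₂ hg₂π hm hsm₀ hsm₀' hgm₀ hgm₀'

/-- Real points: `Hg(T × S)(ℝ) = Hg(T)(ℝ) × Hg(S)(ℝ)` for `T`, `S` simple of CM type. [cite: MoonenZarhin1999LowDim, §5 (5.10)] -/
theorem IsSimple.hodgeGroup_prod_eq_of_hodgeGroup_comm_of_finrank_eq_three_two [Nonempty κ₁] (hT : IsSimple Φ₁) (hS : IsSimple Φ₂)
    (hη₁ : IsRiemannForm Φ₁ η₁) (hη₂ : IsRiemannForm Φ₂ η₂) (h3 : finrank ℂ E₁ = 3) (h2 : finrank ℂ E₂ = 2)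
    (hc₁ : ∀ M ∈ hodgeGroup Φ₁, ∀ N ∈ hodgeGroup Φ₁, M * N = N * M)
    (hc₂ : ∀ M ∈ hodgeGroup Φ₂, ∀ N ∈ hodgeGroup Φ₂, M * N = N * M) :
    hodgeGroup (prodPeriod Φ₁ Φ₂) = ((hodgeGroup Φ₁).prod (hodgeGroup Φ₂)).map (blockDiag κ₁ κ₂) :=
  hodgeGroup_prod_eq_of_hodgeGroupC_prod_eq
    (hT.hodgeGroupC_prod_eq_blockDiagProd_of_hodgeGroup_comm_of_finrank_eq_three_two hS hη₁ hη₂ h3 h2 hc₁ hc₂)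

/-- **(D) for `T × S`, both simple of CM type** (the Hodge group splits and `T`, `S` satisfy (D)).
[cite: MoonenZarhin1999LowDim, Thm. (0.2) (4) (p0002 L1–L8), §5 (5.10), §3 Thm. (3.2) (2)] [cite: Hazama1983, Lemma (3.1)] -/
theorem IsSimple.forall_divisorClasses_powPeriod_prod_eq_hodgeClasses_of_hodgeGroup_comm_of_finrank_eq_three_two [Nonempty κ₁]
    [Nonempty κ₂] (hT : IsSimple Φ₁) (hS : IsSimple Φ₂) (hη₁ : IsRiemannForm Φ₁ η₁) (hη₂ : IsRiemannForm Φ₂ η₂)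
    (h3 : finrank ℂ E₁ = 3) (h2 : finrank ℂ E₂ = 2) (hc₁ : ∀ M ∈ hodgeGroup Φ₁, ∀ N ∈ hodgeGroup Φ₁, M * N = N * M)
    (hc₂ : ∀ M ∈ hodgeGroup Φ₂, ∀ N ∈ hodgeGroup Φ₂, M * N = N * M) :
    ∀ k p, divisorClasses (powPeriod (prodPeriod Φ₁ Φ₂) k) p = hodgeClasses (powPeriod (prodPeriod Φ₁ Φ₂) k) p :=
  forall_divisorClasses_powPeriod_prod_eq_hodgeClasses_of_hodgeGroupC_prod_eq
    (hT.hodgeGroupC_prod_eq_blockDiagProd_of_hodgeGroup_comm_of_finrank_eq_three_two hS hη₁ hη₂ h3 h2 hc₁ hc₂)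
    (hη₁.forall_divisorClasses_powPeriod_eq_hodgeClasses_of_finrank_eq_three h3)
    (IsAbelianVariety.forall_divisorClasses_powPeriod_eq_hodgeClasses_of_finrank_eq_two ⟨η₂, hη₂⟩ h2)

/-- **CONDITION (D) FOR `T × S`, `T` ANY SIMPLE POLARISED ABELIAN THREEFOLD AND `S` ANY SIMPLE POLARISED ABELIAN SURFACE:
`ℬ•((T × S)ⁿ) = 𝒟•((T × S)ⁿ)` for all `n`** — not both of CM type: ✔ g55-#8's dispatch (types I(1), I(3), IV(1,1) for `T`, all
types for `S`, and IV(3,1) × non-CM); both of CM type: the splitting above.  This is Moonen–Zarhin's (5.6)–(5.10) with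
`(d₁,d₂) ∈ {(5,0),(3,2),(2,3),(0,5)}`, `d_min = 2`, for simple factors.
[cite: MoonenZarhin1999LowDim, Thm. (0.2) (4) (p0002 L1–L8), §5 (5.6)–(5.10) (p0009 L122 – p0010 L45), §3 Lemma (3.4), (3.6), (3.7)] -/
theorem IsSimple.forall_divisorClasses_powPeriod_prod_eq_hodgeClasses_of_isSimple_of_finrank_eq_three_two [Nonempty κ₁] [Nonempty κ₂]
    (hT : IsSimple Φ₁) (hS : IsSimple Φ₂) (hη₁ : IsRiemannForm Φ₁ η₁) (hη₂ : IsRiemannForm Φ₂ η₂) (h3 : finrank ℂ E₁ = 3)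
    (h2 : finrank ℂ E₂ = 2) :
    ∀ k p, divisorClasses (powPeriod (prodPeriod Φ₁ Φ₂) k) p = hodgeClasses (powPeriod (prodPeriod Φ₁ Φ₂) k) p := by
  by_cases h : (∀ M ∈ hodgeGroup Φ₁, ∀ N ∈ hodgeGroup Φ₁, M * N = N * M) ∧ ∀ M ∈ hodgeGroup Φ₂, ∀ N ∈ hodgeGroup Φ₂, M * N = N * M
  · exact hT.forall_divisorClasses_powPeriod_prod_eq_hodgeClasses_of_hodgeGroup_comm_of_finrank_eq_three_two hS hη₁ hη₂ h3 h2 h.1 h.2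
  · exact hT.forall_divisorClasses_powPeriod_prod_eq_hodgeClasses_of_finrank_eq_three_two_of_not_and hS hη₁ hη₂ h3 h2 h

end Frames

section Isogenous

variable {ι : Type*} [Fintype ι] [DecidableEq ι] {F : Type*} [NormedAddCommGroup F] [NormedSpace ℂ F]
  {Φ : (ι → ℝ) ≃L[ℝ] F}
  {κ₁ κ₂ : Type} [Fintype κ₁] [DecidableEq κ₁] [Nonempty κ₁] [Fintype κ₂] [DecidableEq κ₂] [Nonempty κ₂]
  {E₁ E₂ : Type} [NormedAddCommGroup E₁] [NormedSpace ℂ E₁] [FiniteDimensional ℂ E₁] [NormedAddCommGroup E₂]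
  [NormedSpace ℂ E₂] [FiniteDimensional ℂ E₂] {Ψ₁ : (κ₁ → ℝ) ≃L[ℝ] E₁} {Ψ₂ : (κ₂ → ℝ) ≃L[ℝ] E₂}
  {η₁ : E₁ [⋀^Fin 2]→L[ℝ] ℝ} {η₂ : E₂ [⋀^Fin 2]→L[ℝ] ℝ}

/-- **Every complex torus isogenous to `T × S` (`T` a simple threefold, `S` a simple surface, both polarised) satisfies (D).**
[cite: MoonenZarhin1999LowDim, Thm. (0.2) (4) (p0002 L1–L8)] [cite: Lange2023AbelianVarietiesComplex, §1.1.2 Cor. 1.1.16] -/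
theorem IsIsogenous.forall_divisorClasses_powPeriod_eq_hodgeClasses_of_prod_of_isSimple_of_finrank_eq_three_two
    (hiso : IsIsogenous Φ (prodPeriod Ψ₁ Ψ₂)) (hT : IsSimple Ψ₁) (hS : IsSimple Ψ₂) (hη₁ : IsRiemannForm Ψ₁ η₁)
    (hη₂ : IsRiemannForm Ψ₂ η₂) (h3 : finrank ℂ E₁ = 3) (h2 : finrank ℂ E₂ = 2) :
    ∀ k p, divisorClasses (powPeriod Φ k) p = hodgeClasses (powPeriod Φ k) p :=
  hiso.forall_powPeriod_divisorClasses_eq_hodgeClasses_iff.2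
    (hT.forall_divisorClasses_powPeriod_prod_eq_hodgeClasses_of_isSimple_of_finrank_eq_three_two hS hη₁ hη₂ h3 h2)

/-- **«`Hg(X) = Sp_D(V,φ)`» for `X ∼ T × S`** (real points, any polarisation `ω`), from (D) by Gordon's Thm. 7.5 (1) ⟹ (2).
[cite: MoonenZarhin1999LowDim, Thm. (0.2) (4) (p0002 L5–L8)] [cite: Gordon1999HodgeAVSurvey, Thm. 7.5 (1) ⟺ (2)] [cite: Milne1999LefschetzClasses, §4 Prop. 4.8] -/
theorem IsRiemannForm.hodgeGroup_eq_lefschetzGroup_of_isIsogenous_prod_of_isSimple_of_finrank_eq_three_two {ι' : Type} [Fintype ι']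
    [DecidableEq ι'] {F' : Type} [NormedAddCommGroup F'] [NormedSpace ℂ F'] [FiniteDimensional ℂ F']
    {Φ' : (ι' → ℝ) ≃L[ℝ] F'} {ω : F' [⋀^Fin 2]→L[ℝ] ℝ} (hω : IsRiemannForm Φ' ω) (hiso : IsIsogenous Φ' (prodPeriod Ψ₁ Ψ₂))
    (hT : IsSimple Ψ₁) (hS : IsSimple Ψ₂) (hη₁ : IsRiemannForm Ψ₁ η₁) (hη₂ : IsRiemannForm Ψ₂ η₂) (h3 : finrank ℂ E₁ = 3)
    (h2 : finrank ℂ E₂ = 2) : hodgeGroup Φ' = lefschetzGroup Φ' ω := by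
  obtain ⟨G, hG⟩ := hω.exists_ratMatrix_latticeGram
  have h0 : 0 < finrank ℂ F' := by
    have hc := hiso.card_eq
    rw [Fintype.card_sum, card_eq_two_mul_finrank Φ', card_eq_two_mul_finrank Ψ₁, h3] at hc
    omega
  exact ((hω.forall_divisorClasses_powPeriod_eq_hodgeClasses_iff_eq_and_hodgeGroup_eq_lefschetzGroup hG h0).1
    (hiso.forall_divisorClasses_powPeriod_eq_hodgeClasses_of_prod_of_isSimple_of_finrank_eq_three_two hT hS hη₁ hη₂ h3 h2)).2

end Isogenous

end ComplexTorus

end Literature.Geometry.Kaehler
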